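import Summits.CriticalPhenomena.PercolationContinuityZ3.Theorems.PercNearOneGluingNoHeavyLowerTailCovTauTransfer
import Summits.CriticalPhenomena.PercolationContinuityZ3.Theorems.PercNearOneGluingAdditiveGluingSetObserverPeel
import HarnessLib

/-!
# Conjecture G / SET-W via a SET observer, IV: the O-slot projection inequality (Harris after conditioning on the peeled cluster)

Support file (`--supports stmt-CriticalPhenomena-4576`); no definitions, no named facts, no sorries.  Seat (b) V⁺-form `png-dp-vplus`, gen 12
(memo MEMO-gen12.md §5, §7 step S2 of run/shared/lean/prim/prim-png-dp-vplus/).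

In the peeling step of the set-observer pre-FKG surplus (the set version of `PreFKGSurplus.preMargin_nonneg_of_csh`), the peeled term
`T_s(O) = ∫_{{O~k}∩{O≁X'}} (F(C_k) − F(C_c))` must be compared with the one-cluster quantity `∫_{{O~k}∩{O≁X'}} G_k(C_k)`,
`G_k(K) = F(V(K)) − E[F(C_c) | C_k = K]` (`CovTau.monotone_projFun`).  For a POINT observer the two are equal (tower property along
`σ(C_k)`, `CovTau.setIntegral_sub_eq_projFun`); for a SET observer the event `{O ≁ X'}` is not `σ(C_k)`-measurable and one has an
INEQUALITY in the right direction: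
* `setIntegral_obs_le_condMean` — `∫_{{O~k}∩{O≁X'}} F(C_c) dμ ≤ ∫_{{O~k}∩{O≁X'}} E[F(C_c) | C_k] dμ`  (`c ∈ X'`, `F` monotone):
  condition on `C_k = K` (vdBHK Lemma 2.4, tree `BHK2006.set_sum_cond_cluster`); in the world off `K̄` the functional `F(C_c)` is increasing and
  the indicator of `{O ∖ V(K) ≁ X'}` is decreasing — Harris.
* `setIntegral_obs_peel_ge_projFun` — consequently `∫_{{O~k}∩{O≁X'}} (F(C_k) − F(C_c)) ≥ ∫_{{O~k}∩{O≁X'}} G_k(C_k)`.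
[cite: VandenbergHaggstromKahn2005, §2.1 Lemma 2.4 (p. 10), §1 p. 6 (Harris)] [cite: KozmaNitzan2024, Conj. 4 (p. 32)]
-/

noncomputable section

namespace Summit.CriticalPhenomena.PercolationContinuityZ3.Theorems

open MeasureTheory Set Literature.Probability.LatticeModels Literature.Probability.Percolation
open Literature.Probability.Percolation.KNPreFKG Literature.Probability.Percolation.BHK2006 Literature.Probability.Percolation.DecisionTree
open scoped Classical

namespace SetSurplus

variable {V : Type*} [Fintype V]

/-- **The O-slot projection inequality.**  For `c ∈ X'`, `F` monotone on vertex sets, an observer set `O` and a vertex `k`: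
`∫_{{O~k}∩{O≁X'}} F(C_c) dμ ≤ ∫_{{O~k}∩{O≁X'}} (∫ F(C_c(η ∖ K̄)) dμ(η))|_{K = C_k} dμ`  (conditional mean of `F(C_c)` given `C_k`).
[cite: VandenbergHaggstromKahn2005, §2.1 Lemma 2.4 (p. 10)] -/
theorem setIntegral_obs_le_condMean (w : Sym2 V → unitInterval) (X' O : Finset V) (F : Set V → ℝ)
    (hF : ∀ S T : Set V, S ⊆ T → F S ≤ F T) (c k : V) (hcX' : c ∈ X') :
    ∫ ω in {ω : BondConfig V | ∃ o ∈ O, (openGraph ω).Reachable o k} ∩ {ω | ∀ o ∈ O, ∀ a ∈ X', ¬ (openGraph ω).Reachable o a},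
        F (openCluster ω c) ∂(prodBernoulli w) ≤
      ∫ ω in {ω : BondConfig V | ∃ o ∈ O, (openGraph ω).Reachable o k} ∩ {ω | ∀ o ∈ O, ∀ a ∈ X', ¬ (openGraph ω).Reachable o a},
        (∫ η, F (openCluster (η \ barOf {k} (openEdgeCluster ω k)) c) ∂(prodBernoulli w)) ∂(prodBernoulli w) := by
  classical
  set μ := prodBernoulli w with hμ
  set w' : Sym2 V → ℝ := fun e => ((w e : unitInterval) : ℝ) with hw'
  have hw0 : ∀ e, 0 ≤ w' e := fun e => (w e).2.1
  have hw1 : ∀ e, w' e ≤ 1 := fun e => (w e).2.2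
  have hm : ∑ ω : Set (Sym2 V), weight w' ω = 1 := by
    have h1 := integral_prodBernoulli_eq_sum w fun _ => (1 : ℝ)
    simp only [integral_const, probReal_univ, smul_eq_mul, mul_one] at h1
    exact h1.symm
  set D : Set (BondConfig V) := {ω | ∀ a ∈ X', ¬ (openGraph ω).Reachable k a} with hD
  have hDiff : ∀ ω : BondConfig V, ω ∈ D ↔ ∀ s ∈ ({k} : Set V), ∀ t ∈ (↑X' : Set V), ¬ (openGraph ω).Reachable s t := by
    intro ω; simp [hD]
  set E : Set (BondConfig V) := {ω : BondConfig V | ∃ o ∈ O, (openGraph ω).Reachable o k} ∩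
    {ω | ∀ o ∈ O, ∀ a ∈ X', ¬ (openGraph ω).Reachable o a} with hE
  have hED : E ⊆ D := by
    rintro ω ⟨⟨o, ho, hok⟩, h2⟩ a ha hka
    exact h2 o ho a ha (hok.trans hka)
  -- the conditional mean and the world indicator, read off `(C_k, C_{X'})`
  set mc : Set (Sym2 V) → ℝ := fun K => ∫ η, F (openCluster (η \ barOf {k} K) c) ∂μ with hmc
  let touchK : Set (Sym2 V) → Prop := fun K => ∃ o ∈ O, o = k ∨ ∃ e ∈ K, o ∈ e
  let avoidL : Set (Sym2 V) → Set (Sym2 V) → Prop := fun K L =>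
    ∀ o ∈ O, ¬ (o = k ∨ ∃ e ∈ K, o ∈ e) → ∀ a ∈ X', ¬ (o = a ∨ ∃ e ∈ openEdgeCluster L a, o ∈ e)
  let Ft : Set (Sym2 V) → ℝ := fun L => F {z | z = c ∨ ∃ e ∈ openEdgeCluster L c, z ∈ e}
  have hFt_app : ∀ L, Ft L = F {z | z = c ∨ ∃ e ∈ openEdgeCluster L c, z ∈ e} := fun L => rfl
  set H : Set (Sym2 V) → Set (Sym2 V) → ℝ := fun K L => (if touchK K ∧ avoidL K L then 1 else 0) * Ft L with hH
  set H' : Set (Sym2 V) → Set (Sym2 V) → ℝ := fun K L => (if touchK K ∧ avoidL K L then 1 else 0) * mc K with hH'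
  have key1 := set_sum_cond_cluster w' hm ({k} : Set V) (↑X' : Set V) H hDiff
  have key2 := set_sum_cond_cluster w' hm ({k} : Set V) (↑X' : Set V) H' hDiff
  simp only [setCl_singleton] at key1 key2
  -- identification of the event on `D`
  have hFt : ∀ ω : BondConfig V, Ft (setCl ω ↑X') = F (openCluster ω c) := by
    intro ω
    rw [hFt_app]; simp only [setCl]
    rw [CovTauStarN.openEdgeCluster_biUnion_eq (Finset.mem_coe.2 hcX'), clusterFun_openEdgeCluster F ω c]
  have hev : ∀ ω : BondConfig V, ω ∈ D → ((touchK (openEdgeCluster ω k) ∧ avoidL (openEdgeCluster ω k) (setCl ω ↑X')) ↔ ω ∈ E) := by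
    intro ω hωD
    constructor
    · rintro ⟨⟨o, ho, hto⟩, hav⟩
      refine ⟨⟨o, ho, ((reachable_iff_exists_mem_openEdgeCluster ω k o).2 hto).symm⟩, fun o' ho' a ha hoa => ?_⟩
      by_cases hin : o' = k ∨ ∃ e ∈ openEdgeCluster ω k, o' ∈ e
      · exact hωD a ha (((reachable_iff_exists_mem_openEdgeCluster ω k o').2 hin).trans hoa)
      · refine hav o' ho' hin a ha ?_
        have := (reachable_iff_exists_mem_openEdgeCluster ω a o').1 hoa.symm
        simp only [setCl]
        rwa [CovTauStarN.openEdgeCluster_biUnion_eq (Finset.mem_coe.2 ha)]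
    · rintro ⟨⟨o, ho, hok⟩, hav⟩
      refine ⟨⟨o, ho, (reachable_iff_exists_mem_openEdgeCluster ω k o).1 hok.symm⟩, fun o' ho' _ a ha h => ?_⟩
      simp only [setCl] at h
      rw [CovTauStarN.openEdgeCluster_biUnion_eq (Finset.mem_coe.2 ha)] at h
      exact hav o' ho' a ha ((reachable_iff_exists_mem_openEdgeCluster ω a o').2 h).symm
  have hL : ∀ ω : BondConfig V, H (openEdgeCluster ω k) (setCl ω ↑X') * ind D ω = E.indicator (fun ω => F (openCluster ω c)) ω := by
    intro ω
    by_cases hωD : ω ∈ D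
    · rw [ind_of_mem hωD, mul_one]
      simp only [hH]
      by_cases hωE : ω ∈ E
      · rw [if_pos ((hev ω hωD).2 hωE), indicator_of_mem hωE, one_mul, hFt]
      · rw [if_neg (fun h => hωE ((hev ω hωD).1 h)), indicator_of_notMem hωE, zero_mul]
    · rw [ind_of_not_mem hωD, mul_zero, indicator_of_notMem (fun h => hωD (hED h))]
  have hR : ∀ ω : BondConfig V, H' (openEdgeCluster ω k) (setCl ω ↑X') * ind D ω =
      E.indicator (fun ω => ∫ η, F (openCluster (η \ barOf {k} (openEdgeCluster ω k)) c) ∂μ) ω := by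
    intro ω
    by_cases hωD : ω ∈ D
    · rw [ind_of_mem hωD, mul_one]
      simp only [hH']
      by_cases hωE : ω ∈ E
      · rw [if_pos ((hev ω hωD).2 hωE), indicator_of_mem hωE, one_mul]
      · rw [if_neg (fun h => hωE ((hev ω hωD).1 h)), indicator_of_notMem hωE, zero_mul]
    · rw [ind_of_not_mem hωD, mul_zero, indicator_of_notMem (fun h => hωD (hED h))]
  -- Harris in the world, for every value `K` of `C_k`
  have hworld : ∀ K : Set (Sym2 V),
      ∑ η : Set (Sym2 V), weight w' η * H K (setCl (η \ barOf {k} K) ↑X') ≤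
        ∑ η : Set (Sym2 V), weight w' η * H' K (setCl (η \ barOf {k} K) ↑X') := by
    intro K
    by_cases htK : touchK K
    · set B := barOf ({k} : Set V) K with hB
      set f : Set (Sym2 V) → ℝ := fun η => Ft (setCl (η \ B) ↑X') with hf
      set g : Set (Sym2 V) → ℝ := fun η => if avoidL K (setCl (η \ B) ↑X') then 1 else 0 with hg
      have hfmono : Monotone f := by
        intro η η' hle
        simp only [hf, hFt_app, setCl]
        refine monotone_clusterFun c F hF (openEdgeCluster_mono ?_ c)
        exact iUnion₂_mono fun a _ => openEdgeCluster_mono (sdiff_le_sdiff_right hle) a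
      have hganti : Antitone g := by
        intro η η' hle
        simp only [hg]
        by_cases h' : avoidL K (setCl (η' \ B) ↑X')
        · rw [if_pos h']
          have h : avoidL K (setCl (η \ B) ↑X') := by
            intro o ho hno a ha hoe
            refine h' o ho hno a ha (hoe.imp id fun ⟨e, he, hoe⟩ => ⟨e, ?_, hoe⟩)
            refine openEdgeCluster_mono ?_ a he
            exact iUnion₂_mono fun a _ => openEdgeCluster_mono (sdiff_le_sdiff_right hle) a
          rw [if_pos h]
        · rw [if_neg h']; split_ifs <;> norm_num
      have hf0 : ∀ η, 0 ≤ f η - f ∅ := fun η => sub_nonneg.2 (hfmono (empty_subset η))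
      have hfm' : Monotone fun η => f η - f ∅ := fun η η' h => sub_le_sub_right (hfmono h) _
      have hgM : ∀ η, g η ≤ 1 := fun η => by simp only [hg]; split_ifs <;> norm_num
      have hHar := harris_mono_anti hw0 hw1 hm hf0 hfm' hganti hgM
      -- `Σ w f = mc K`
      have hfsum : ∑ η : Set (Sym2 V), weight w' η * f η = mc K := by
        simp only [hmc]
        rw [integral_prodBernoulli_eq_sum]
        refine Finset.sum_congr rfl fun η _ => ?_
        simp only [hf, hFt_app, setCl]
        rw [CovTauStarN.openEdgeCluster_biUnion_eq (Finset.mem_coe.2 hcX'), clusterFun_openEdgeCluster F (η \ B) c]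
      have e1 : ∀ η : Set (Sym2 V), weight w' η * H K (setCl (η \ B) ↑X') = weight w' η * (f η * g η) := by
        intro η; simp only [hH, hf, hg]
        by_cases h : avoidL K (setCl (η \ B) ↑X')
        · rw [if_pos ⟨htK, h⟩, if_pos h]; ring
        · rw [if_neg (fun h2 => h h2.2), if_neg h]; ring
      have e2 : ∀ η : Set (Sym2 V), weight w' η * H' K (setCl (η \ B) ↑X') = mc K * (weight w' η * g η) := by
        intro η; simp only [hH', hg]
        by_cases h : avoidL K (setCl (η \ B) ↑X')
        · rw [if_pos ⟨htK, h⟩, if_pos h]; ring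
        · rw [if_neg (fun h2 => h h2.2), if_neg h]; ring
      rw [Finset.sum_congr rfl fun η _ => e1 η, Finset.sum_congr rfl fun η _ => e2 η, ← Finset.mul_sum, ← hfsum]
      have e3 : ∑ η : Set (Sym2 V), weight w' η * ((f η - f ∅) * g η) =
          ∑ η : Set (Sym2 V), weight w' η * (f η * g η) - f ∅ * ∑ η : Set (Sym2 V), weight w' η * g η := by
        rw [Finset.mul_sum, ← Finset.sum_sub_distrib]
        exact Finset.sum_congr rfl fun η _ => by ring
      have e4 : ∑ η : Set (Sym2 V), weight w' η * (f η - f ∅) = ∑ η : Set (Sym2 V), weight w' η * f η - f ∅ := by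
        rw [Finset.sum_congr rfl fun η _ => by rw [mul_sub], Finset.sum_sub_distrib, ← Finset.sum_mul, hm, one_mul]
      rw [e3, e4] at hHar
      nlinarith [hHar]
    · -- `O` does not touch `K`: both sides vanish
      have e0 : ∀ L, H K L = 0 := fun L => by simp only [hH]; rw [if_neg (fun h => htK h.1), zero_mul]
      have e0' : ∀ L, H' K L = 0 := fun L => by simp only [hH']; rw [if_neg (fun h => htK h.1), zero_mul]
      simp only [e0, e0', mul_zero, Finset.sum_const_zero, le_refl]
  -- assemble
  rw [← integral_indicator (MeasurableSet.of_discrete), ← integral_indicator (MeasurableSet.of_discrete),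
    integral_prodBernoulli_eq_sum, integral_prodBernoulli_eq_sum]
  simp only [← hL, ← hR]
  rw [key1, key2]
  refine Finset.sum_le_sum fun ω _ => ?_
  refine mul_le_mul_of_nonneg_left ?_ (weight_nonneg hw0 hw1 ω)
  exact mul_le_mul_of_nonneg_right (hworld _) (ind_nonneg D ω)

/-- **The peeled term of the set-observer surplus dominates the projected functional**: with `G_k(K) = F(V(K)) − E[F(C_c) | C_k = K]`,
`∫_{{O~k}∩{O≁X'}} G_k(C_k) dμ ≤ ∫_{{O~k}∩{O≁X'}} (F(C_k) − F(C_c)) dμ`. [cite: VandenbergHaggstromKahn2005, §2.1 Lemma 2.4 (p. 10)] -/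
theorem setIntegral_obs_peel_ge_projFun (w : Sym2 V → unitInterval) (X' O : Finset V) (F : Set V → ℝ)
    (hF : ∀ S T : Set V, S ⊆ T → F S ≤ F T) (c k : V) (hcX' : c ∈ X') :
    ∫ ω in {ω : BondConfig V | ∃ o ∈ O, (openGraph ω).Reachable o k} ∩ {ω | ∀ o ∈ O, ∀ a ∈ X', ¬ (openGraph ω).Reachable o a},
        (F {z | z = k ∨ ∃ e ∈ openEdgeCluster ω k, z ∈ e} -
          ∫ η, F (openCluster (η \ barOf {k} (openEdgeCluster ω k)) c) ∂(prodBernoulli w)) ∂(prodBernoulli w) ≤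
      ∫ ω in {ω : BondConfig V | ∃ o ∈ O, (openGraph ω).Reachable o k} ∩ {ω | ∀ o ∈ O, ∀ a ∈ X', ¬ (openGraph ω).Reachable o a},
        (F (openCluster ω k) - F (openCluster ω c)) ∂(prodBernoulli w) := by
  have hint : ∀ (g : BondConfig V → ℝ) (S : Set (BondConfig V)), IntegrableOn g S (prodBernoulli w) :=
    fun g S => (Integrable.of_finite).integrableOn
  rw [integral_sub (hint _ _) (hint _ _), integral_sub (hint _ _) (hint _ _)]
  have e1 : ∫ ω in {ω : BondConfig V | ∃ o ∈ O, (openGraph ω).Reachable o k} ∩ {ω | ∀ o ∈ O, ∀ a ∈ X', ¬ (openGraph ω).Reachable o a},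
      F {z | z = k ∨ ∃ e ∈ openEdgeCluster ω k, z ∈ e} ∂(prodBernoulli w) =
      ∫ ω in {ω : BondConfig V | ∃ o ∈ O, (openGraph ω).Reachable o k} ∩ {ω | ∀ o ∈ O, ∀ a ∈ X', ¬ (openGraph ω).Reachable o a},
      F (openCluster ω k) ∂(prodBernoulli w) :=
    setIntegral_congr_fun (MeasurableSet.of_discrete) fun ω _ => clusterFun_openEdgeCluster F ω k
  rw [e1]
  linarith [setIntegral_obs_le_condMean w X' O F hF c k hcX']

end SetSurplus

end Summit.CriticalPhenomena.PercolationContinuityZ3.Theorems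

end
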